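import Summits.ResolutionOfSingularities.ResolutionOfSingularities.Theorems.MarkedTransferCampaignW24ReducedBridgeQ
import Summits.ResolutionOfSingularities.ResolutionOfSingularities.Theorems.MarkedTransferCampaignW24ReducedBridgeDigitOne
import Mathlib.Data.Finsupp.Lex
import HarnessLib

/-!
# The LEVEL-`q` bridge, part 2: data at level `e ≥ 1` (`q = 2^e`, one variable, characteristic 2) for carriers
# `F = Φ_{q,r₀} G + R` — top residue `r₀`, passenger `R` below it (HIRONAKA-L · cell `res-hironaka` · slot W2.4 «bottom-member re-run»;
# generalises res-D-pv-020's `e = 1` files `…ReducedBridge{Run,DigitOne,Mixed}.lean`)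

**HONEST FRAMING.** OURS throughout: kernel theorems connecting OURS objects of the cell (res-L1-k24's `CampaignW24.ReducedRun`, res-type-059's
`CampaignW24.stepAt` etc., res-D-pv-020's `CampaignW24.ReducedBridge`). Nothing below is a statement of H. Hironaka's manuscript [Hironaka2017]
(lit key `paper:url-3343fd9e678b`), nothing asserts that any statement of it holds, nothing is a claim about resolution of singularities in
characteristic `p`; the manuscript stays «under review» (D-0012/D-0089). AI work, weaker than expert review. Written by res-D-pv-020 (W2.4 lineage).

## What is proved (`K` a field of characteristic 2; `0 < e ≤ ℓ`; `q = 2^e`; `F = Φ_{q,r₀} G + R`, `r₀ < q`, `ResIn q good R`, `good ⊆ PairLT · r₀`)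
* §1 digit bookkeeping for data of depth `ℓ` at level `e` (`n = 1`): residues of summands, the top residue.
* §2 data of `F` (`G ≠ 0`, `ord G = k`): top pair = digits of `r₀` (`alpha_beta_of_level`), `γ_* = k·e₀`, `DepthBox ⟺ k < 2^{ℓ−e}`,
  `u_* = Ψ_q(unitPart 2^{ℓ−e} k G)` under `SoleBottom`, `w = Ψ_q((unitPart …)⁻¹)`.
* §0 `ReducedRun.canonStepIIIq` / `univStepIIIq` (reduced Case-(III) step with a general iteration count `k̄`; the linear term cancels).
(The one-step formulas follow in `…ReducedBridgeQStep.lean`.)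
Hypotheses: each theorem's own binders; no FACT-LIST fact, no DEFECT binder. Standard axioms only.
-/

noncomputable section

set_option linter.dupNamespace false -- mandated namespace of this single-conjunct summit

namespace Summit.ResolutionOfSingularities.ResolutionOfSingularities.Theorems

namespace CampaignW24

/-! ## §0 The reduced Case-(III) step with a general iteration count `k̄` -/

namespace ReducedRun

open PowerSeries

universe u

variable {K : Type u} [Field K]

/-- [OURS · W2.4 reduced model] canonical reduced Case-(III) step at bottom digit `1`, depth `P`, iteration count `k̄`:
`G ↦ G − (u_*)^{−(2^{k̄}−1)}·(h♭)^{k̄} G`, `u_* = unitPart P 1 G`. Bookkeeping definition. [folklore] -/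
def canonStepIIIq (P kb : ℕ) (G : K⟦X⟧) : K⟦X⟧ := G - (unitPart P 1 G)⁻¹ ^ (2 ^ kb - 1) * twinPre^[kb] G

/-- [OURS · W2.4 reduced model] the universal (depth-free) version: `G ↦ G − c^{−(2^{k̄}−1)}·twinPre^{[k̄]} G`, `c = coeff₁ G`. [folklore] -/
def univStepIIIq (kb : ℕ) (G : K⟦X⟧) : K⟦X⟧ := G - C (coeff 1 G)⁻¹ ^ (2 ^ kb - 1) * twinPre^[kb] G

/-- Beyond the support the canonical step is the universal one. [folklore] -/
theorem canonStepIIIq_eq_univStepIIIq {P kb : ℕ} {G : K⟦X⟧} (hG : ∀ m, P ≤ m → coeff m G = 0) :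
    canonStepIIIq P kb G = univStepIIIq kb G := by
  rw [canonStepIIIq, univStepIIIq, unitPart_eq_C_of_coeff_eq_zero hG, C_inv]

/-- No constant term (`G(0) = 0`). [folklore] -/
theorem constantCoeff_univStepIIIq {kb : ℕ} {G : K⟦X⟧} (h0 : constantCoeff G = 0) : constantCoeff (univStepIIIq kb G) = 0 := by
  rw [univStepIIIq, map_sub, map_mul, (coeff_twinPre_iterate h0 kb).1, mul_zero, sub_zero, h0]

/-- **The linear terms cancel**: `c − c^{−(2^{k̄}−1)}·c^{2^{k̄}} = 0`. [folklore] -/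
theorem coeff_one_univStepIIIq (kb : ℕ) {G : K⟦X⟧} (h0 : constantCoeff G = 0) : coeff 1 (univStepIIIq kb G) = 0 := by
  rw [univStepIIIq, map_sub, ← map_pow, coeff_C_mul, (coeff_twinPre_iterate h0 kb).2]
  by_cases hc : coeff 1 G = 0
  · rw [hc, zero_pow (pow_ne_zero kb two_ne_zero), mul_zero, sub_zero]
  · have h2 : (coeff 1 G) ^ 2 ^ kb = (coeff 1 G) ^ (2 ^ kb - 1) * coeff 1 G := by
      rw [← pow_succ, Nat.sub_add_cancel Nat.one_le_two_pow]
    rw [h2, ← mul_assoc, ← mul_pow, inv_mul_cancel₀ hc, one_pow, one_mul, sub_self]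

/-- Hence `2 ≤ ord (univStepIIIq k̄ G)` (`G(0) = 0`). [folklore] -/
theorem two_le_order_univStepIIIq (kb : ℕ) {G : K⟦X⟧} (h0 : constantCoeff G = 0) :
    (2 : ℕ∞) ≤ order (univStepIIIq kb G) := by
  refine nat_le_order _ 2 fun i hi => ?_
  interval_cases i
  · rw [coeff_zero_eq_constantCoeff]; exact constantCoeff_univStepIIIq h0
  · exact coeff_one_univStepIIIq kb h0

/-- Finite support (bound `(2^{k̄} + 1)·B`). [folklore] -/
theorem coeff_univStepIIIq_eq_zero_of_bound {kb : ℕ} {G : K⟦X⟧} {B : ℕ} (hG : ∀ m, B < m → coeff m G = 0) :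
    ∀ m, (2 ^ kb + 1) * B < m → coeff m (univStepIIIq kb G) = 0 := fun m hm => by
  have h1 : B ≤ (2 ^ kb + 1) * B := Nat.le_mul_of_pos_left B (by positivity)
  have h2 : 2 ^ kb * B ≤ (2 ^ kb + 1) * B := Nat.mul_le_mul_right B (Nat.le_succ _)
  rw [univStepIIIq, map_sub, ← map_pow, coeff_C_mul, hG m (by omega),
    coeff_twinPre_iterate_eq_zero_of_bound hG kb m (by omega), mul_zero, sub_zero]

end ReducedRun

namespace ReducedBridge

open Literature.AlgebraicGeometry.Hironaka2017.S08UnitMonomial (StandardExpression)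
open Literature.AlgebraicGeometry.Hironaka2017.S09LLUED
open Literature.AlgebraicGeometry.Hironaka2017.S09LLUED.TopFrontier
open Literature.AlgebraicGeometry.Hironaka2017.S09LLUED.TopDeriv
open Literature.AlgebraicGeometry.Hironaka2017.S09LLUED.FrontierDrop (expo)
open Literature.RingTheory.MvPowerSeries (hasseDeriv coeff_hasseDeriv)
open CampaignW21 (xs hasseD)

variable {K : Type} [Field K]

/-- `2^e ≠ 0`. [folklore] -/
theorem two_pow_ne_zero' (e : ℕ) : (2 ^ e : ℕ) ≠ 0 := pow_ne_zero e two_ne_zero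

/-! ## §1 Digit bookkeeping at level `e` (`n = 1`) -/

section Digits

variable {e ℓ : ℕ} {F : MvPowerSeries (Fin 1) K}

/-- The two digits of a summand combine to a residue `< 2^e` (`a < 2`, `b < 2^{e−1}`, `e ≥ 1`). [folklore] -/
theorem digits_lt (X : StandardExpression 2 (xs K 1) e ℓ F) (he : 0 < e) {s : ExpTriple 1} (hs : s ∈ X.support) :
    s.1 0 + 2 * s.2.1 0 < 2 ^ e := by
  have ha := X.a_lt _ hs 0
  have hb := X.b_lt _ hs 0
  have h2 : 2 * 2 ^ (e - 1) = 2 ^ e := by rw [← pow_succ']; congr 1; omega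
  omega

/-- The residue of the exponent of a summand is `a + 2b`. [folklore] -/
theorem expo_mod (X : StandardExpression 2 (xs K 1) e ℓ F) (he : 0 < e) {s : ExpTriple 1} (hs : s ∈ X.support) :
    expo 2 e s 0 % 2 ^ e = s.1 0 + 2 * s.2.1 0 := by
  have h := digits_lt X he hs
  rw [expo]
  simp only [Finsupp.add_apply, Finsupp.smul_apply, smul_eq_mul]
  rw [show s.1 0 + 2 * s.2.1 0 + 2 ^ e * s.2.2 0 = (s.1 0 + 2 * s.2.1 0) + 2 ^ e * s.2.2 0 by ring, Nat.add_mul_mod_self_left,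
    Nat.mod_eq_of_lt h]

omit [Field K] in
/-- `single (r % 2) + 2 • single (r / 2) = single r` on `Fin 1`. [folklore] -/
theorem single_digits (r : ℕ) : Finsupp.single (0 : Fin 1) (r % 2) + 2 • Finsupp.single (0 : Fin 1) (r / 2) = Finsupp.single 0 r := by
  rw [Finsupp.smul_single, ← Finsupp.single_add]; congr 1; rw [smul_eq_mul]; omega

omit [Field K] in
/-- On `Fin 1`: `toLex (x·e₀) < toLex (y·e₀) ↔ x < y`. [folklore] -/
theorem toLex_single_lt_iff {x y : ℕ} :
    toLex (Finsupp.single (0 : Fin 1) x) < toLex (Finsupp.single (0 : Fin 1) y) ↔ x < y := by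
  rw [Finsupp.Lex.lt_iff_of_unique, show (default : Fin 1) = 0 from Subsingleton.elim _ _]
  show Finsupp.single (0 : Fin 1) x 0 < Finsupp.single (0 : Fin 1) y 0 ↔ x < y
  rw [Finsupp.single_eq_same, Finsupp.single_eq_same]

end Digits

/-! ## §2 Data of `F = Φ_{q,r₀} G + R` at level `e` -/

section Datum

variable [CharP K 2] {e ℓ : ℕ} {F R : MvPowerSeries (Fin 1) K} {G : PowerSeries K} {r₀ : ℕ} {good : ℕ → Prop}

omit [CharP K 2] in
/-- The top residue class reads `G`: `coeff_{r₀ + q·m} F = coeff_m G`. [folklore] -/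
theorem coeff_top_residue (hF : F = phiQ (2 ^ e) (two_pow_ne_zero' e) r₀ G + R) (hr₀ : r₀ < 2 ^ e) (hR : ResIn (2 ^ e) good R)
    (hgood : ∀ ρ, good ρ → PairLT ρ r₀) (m : ℕ) :
    MvPowerSeries.coeff (Finsupp.single 0 (r₀ + 2 ^ e * m)) F = PowerSeries.coeff m G := by
  rw [hF, map_add, coeff_phiQ_add _ hr₀, hR.coeff_eq_zero, add_zero]
  rw [Finsupp.single_eq_same, Nat.add_mul_mod_self_left, Nat.mod_eq_of_lt hr₀]
  exact fun h => (hgood _ h).ne rfl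

omit [CharP K 2] in
/-- Off the top residue class `F` reads the passenger. [folklore] -/
theorem coeff_off_residue (hF : F = phiQ (2 ^ e) (two_pow_ne_zero' e) r₀ G + R) (hr₀ : r₀ < 2 ^ e) {d : Fin 1 →₀ ℕ}
    (hd : d 0 % 2 ^ e ≠ r₀) : MvPowerSeries.coeff d F = MvPowerSeries.coeff d R := by
  rw [hF, map_add, coeff_phiQ_of_lt _ hr₀, if_neg hd, zero_add]

/-- **Top pair of every datum** of `F` (`G ≠ 0`, depth `ℓ ≥ e > 0`): `(α, β)` are the digits `(r₀ % 2, r₀ / 2)` of the top residue.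
[folklore] -/
theorem alpha_beta_of_level (X : StandardExpression 2 (xs K 1) e ℓ F) (hF : F = phiQ (2 ^ e) (two_pow_ne_zero' e) r₀ G + R)
    (hr₀ : r₀ < 2 ^ e) (hR : ResIn (2 ^ e) good R) (hgood : ∀ ρ, good ρ → PairLT ρ r₀) (he : 0 < e) (hle : e ≤ ℓ) (hG : G ≠ 0) :
    alpha X.support X.u = Finsupp.single 0 (r₀ % 2) ∧ beta X.support X.u = Finsupp.single 0 (r₀ / 2) := by
  haveI : Fact (Nat.Prime 2) := ⟨Nat.prime_two⟩
  -- a visible top-residue monomial and its effective summand `s`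
  obtain ⟨k, hk⟩ : ∃ k, PowerSeries.coeff k G ≠ 0 := by
    by_contra h
    push Not at h
    exact hG (PowerSeries.ext fun k => by rw [h k, map_zero])
  have hc : MvPowerSeries.coeff (Finsupp.single 0 (r₀ + 2 ^ e * k)) F ≠ 0 := by rwa [coeff_top_residue hF hr₀ hR hgood]
  obtain ⟨s, hs, r, hr⟩ := exists_mem_effSupport_of_coeff_ne_zero hle X hc
  have hss := (mem_effSupport.mp hs).1
  have hs_dig : s.1 0 + 2 * s.2.1 0 = r₀ := by
    have h := congr_arg (fun f : Fin 1 →₀ ℕ => f 0 % 2 ^ e) hr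
    simp only [Finsupp.single_eq_same, Finsupp.add_apply, Finsupp.smul_apply, smul_eq_mul] at h
    rw [Nat.add_mul_mod_self_left, Nat.mod_eq_of_lt hr₀, show s.1 0 + 2 * s.2.1 0 + 2 ^ e * r 0 =
      (s.1 0 + 2 * s.2.1 0) + 2 ^ e * r 0 by ring, Nat.add_mul_mod_self_left, Nat.mod_eq_of_lt (digits_lt X he hss)] at h
    exact h.symm
  have hs1 : s.1 0 = r₀ % 2 := by have := X.a_lt _ hss 0; omega
  have hs2 : s.2.1 0 = r₀ / 2 := by have := X.a_lt _ hss 0; omega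
  -- the top summand `t` and a visible monomial of its residue
  obtain ⟨t, ht, h1, h2⟩ := exists_top_of_nonempty ⟨s, hs⟩
  obtain ⟨m, hm, hmod⟩ := TopDeriv.exists_coeff_ne_zero_of_mem_effSupport he hle X ht
  have hts := (mem_effSupport.mp ht).1
  have hres : m 0 % 2 ^ e = t.1 0 + 2 * t.2.1 0 := by rw [← expo_mod X he hts]; exact hmod 0
  by_cases hρ : m 0 % 2 ^ e = r₀
  · -- the top summand has the digits of `r₀`
    have ht1 : t.1 0 = r₀ % 2 := by have := X.a_lt _ hts 0; omega
    have ht2 : t.2.1 0 = r₀ / 2 := by have := X.a_lt _ hts 0; omega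
    rw [← h1, ← h2, eq_single t.1, eq_single t.2.1, ht1, ht2]
    exact ⟨rfl, rfl⟩
  · -- otherwise the top pair lies strictly below the pair of `s`: contradiction with `pairKey_le_top`
    exfalso
    have hmR : MvPowerSeries.coeff m R ≠ 0 := by rwa [coeff_off_residue hF hr₀ hρ] at hm
    have hlt : PairLT (t.1 0 + 2 * t.2.1 0) r₀ := hres ▸ hgood _ (hR m hmR)
    have hlt' : t.1 0 < r₀ % 2 ∨ (t.1 0 = r₀ % 2 ∧ t.2.1 0 < r₀ / 2) := by
      have hta : t.1 0 < 2 := X.a_lt _ hts 0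
      rcases hlt with h | ⟨h1', h2'⟩
      · left; omega
      · right; constructor <;> omega
    have hle_s := pairKey_le_top hs
    have htop : toLex (toLex (alpha X.support X.u), toLex (beta X.support X.u)) < pairKey s := by
      rw [← h1, ← h2, pairKey, eq_single t.1, eq_single t.2.1, eq_single s.1, eq_single s.2.1, hs1, hs2]
      rcases hlt' with h | ⟨h1', h2'⟩
      · exact Prod.Lex.toLex_lt_toLex.mpr (Or.inl (toLex_single_lt_iff.mpr h))
      · rw [h1']
        exact Prod.Lex.toLex_lt_toLex.mpr (Or.inr ⟨rfl, toLex_single_lt_iff.mpr h2'⟩)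
    exact absurd (lt_of_lt_of_le htop hle_s) (lt_irrefl _)

/-- **`γ_* = k·e₀`** (`ord G = k`) on every datum of `F` with non-empty top block. [folklore] -/
theorem gammaStar_of_level (X : StandardExpression 2 (xs K 1) e ℓ F) (hF : F = phiQ (2 ^ e) (two_pow_ne_zero' e) r₀ G + R)
    (hr₀ : r₀ < 2 ^ e) (hR : ResIn (2 ^ e) good R) (hgood : ∀ ρ, good ρ → PairLT ρ r₀) (he : 0 < e) (hle : e ≤ ℓ)
    (h0 : 0 < frontierLength X.support X.u) {k : ℕ} (hk : PowerSeries.order G = k) :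
    gammaStar X.support X.u = Finsupp.single 0 k := by
  haveI : Fact (Nat.Prime 2) := ⟨Nat.prime_two⟩
  have hG : G ≠ 0 := fun h => by rw [h, PowerSeries.order_zero] at hk; exact ENat.top_ne_coe k hk
  obtain ⟨hα, hβ⟩ := alpha_beta_of_level X hF hr₀ hR hgood he hle hG
  obtain ⟨hk0, hklt⟩ := PowerSeries.order_eq_nat.mp hk
  have hAB : topFrontierExp 2 X.support X.u = Finsupp.single 0 r₀ := by rw [topFrontierExp, hα, hβ, single_digits]
  have hc := coeff_bottomExp_ne_zero X he hle h0
  have hbot : bottomExp 2 e X.support X.u = Finsupp.single 0 (r₀ + 2 ^ e * gammaStar X.support X.u 0) := by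
    rw [bottomExp, ← topFrontierExp, hAB, eq_single (gammaStar X.support X.u)]
    refine Finsupp.ext fun s => ?_
    have hs : s = 0 := Subsingleton.elim _ _
    subst hs
    simp only [Finsupp.add_apply, Finsupp.smul_apply, Finsupp.single_eq_same, smul_eq_mul]
  rw [hbot, coeff_top_residue hF hr₀ hR hgood] at hc
  have h1 : k ≤ gammaStar X.support X.u 0 := by
    by_contra hlt
    exact hc (hklt _ (by omega))
  have h2 := toLex_gammaStar_le_of_coeff_ne_zero X he hle h0 (c := Finsupp.single 0 k) (by
    have : topFrontierExp 2 X.support X.u + 2 ^ e • Finsupp.single 0 k = Finsupp.single 0 (r₀ + 2 ^ e * k) := by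
      rw [hAB, Finsupp.smul_single, ← Finsupp.single_add, smul_eq_mul]
    rw [this, coeff_top_residue hF hr₀ hR hgood]
    exact hk0)
  have h3 : Finsupp.single 0 k ≤ gammaStar X.support X.u := by
    intro s
    have hs : s = 0 := Subsingleton.elim _ _
    subst hs
    simpa using h1
  exact (toLex_inj.mp (le_antisymm (Finsupp.toLex_monotone h3) h2)).symm

/-- **`DepthBox ⟺ k < 2^{ℓ−e}`** on a datum of `F` (`ord G = k`, `e ≤ ℓ`). [folklore] -/
theorem depthBox_iff_of_level (X : StandardExpression 2 (xs K 1) e ℓ F) (hF : F = phiQ (2 ^ e) (two_pow_ne_zero' e) r₀ G + R)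
    (hr₀ : r₀ < 2 ^ e) (hR : ResIn (2 ^ e) good R) (hgood : ∀ ρ, good ρ → PairLT ρ r₀) (he : 0 < e) (hle : e ≤ ℓ)
    (h0 : 0 < frontierLength X.support X.u) {k : ℕ} (hk : PowerSeries.order G = k) :
    DepthBox 2 e ℓ X.support X.u ↔ k < 2 ^ (ℓ - e) := by
  rw [DepthBox, gammaStar_of_level X hF hr₀ hR hgood he hle h0 hk]
  have h2 : 2 ^ ℓ = 2 ^ e * 2 ^ (ℓ - e) := by rw [← pow_add]; congr 1; omega
  have hq : 0 < 2 ^ e := pow_pos two_pos e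
  constructor
  · intro h
    have := h 0
    simp only [Finsupp.smul_apply, Finsupp.single_eq_same, smul_eq_mul] at this
    rw [h2] at this
    exact Nat.lt_of_mul_lt_mul_left this
  · intro h s
    have hs : s = 0 := Subsingleton.elim _ _
    subst hs
    simp only [Finsupp.smul_apply, Finsupp.single_eq_same, smul_eq_mul]
    rw [h2]
    exact Nat.mul_lt_mul_of_pos_left h hq

/-- **`u_* = Ψ_q(unitPart 2^{ℓ−e} k G)`** under `SoleBottom` — class isolation reads the top residue class, where the passenger is absent.
[folklore] -/
theorem uStar_of_level (X : StandardExpression 2 (xs K 1) e ℓ F) (hF : F = phiQ (2 ^ e) (two_pow_ne_zero' e) r₀ G + R)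
    (hr₀ : r₀ < 2 ^ e) (hR : ResIn (2 ^ e) good R) (hgood : ∀ ρ, good ρ → PairLT ρ r₀) (he : 0 < e) (hle : e ≤ ℓ)
    (h0 : 0 < frontierLength X.support X.u) {k : ℕ} (hk : PowerSeries.order G = k) (hsole : SoleBottom 2 e ℓ X.support X.u) :
    uStar X.support X.u = psiQ (2 ^ e) (two_pow_ne_zero' e) (ReducedRun.unitPart (2 ^ (ℓ - e)) k G) := by
  haveI : Fact (Nat.Prime 2) := ⟨Nat.prime_two⟩
  have hG : G ≠ 0 := fun h => by rw [h, PowerSeries.order_zero] at hk; exact ENat.top_ne_coe k hk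
  obtain ⟨hα, hβ⟩ := alpha_beta_of_level X hF hr₀ hR hgood he hle hG
  have hγ := gammaStar_of_level X hF hr₀ hR hgood he hle h0 hk
  have h2 : 2 ^ ℓ = 2 ^ e * 2 ^ (ℓ - e) := by rw [← pow_add]; congr 1; omega
  have hqpos : 0 < 2 ^ e := pow_pos two_pos e
  ext d
  by_cases hd : 2 ^ ℓ ∣ d 0
  · obtain ⟨m, hm⟩ := hd
    have hdμ : d = 2 ^ ℓ • Finsupp.single 0 m := by rw [eq_single d, hm, Finsupp.smul_single, smul_eq_mul]
    have h1 := coeff_bottomExp_add_eq_coeff_uStar X he hle h0 hsole (Finsupp.single 0 m)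
    rw [← hdμ] at h1
    rw [← h1]
    have h3 : bottomExp 2 e X.support X.u + d = Finsupp.single 0 (r₀ + 2 ^ e * (k + 2 ^ (ℓ - e) * m)) := by
      rw [bottomExp, ← topFrontierExp, topFrontierExp, hα, hβ, single_digits, hγ, eq_single d, hm, h2]
      refine Finsupp.ext fun s => ?_
      have hs : s = 0 := Subsingleton.elim _ _
      subst hs
      simp only [Finsupp.add_apply, Finsupp.smul_apply, Finsupp.single_eq_same, smul_eq_mul]
      ring
    rw [h3, coeff_top_residue hF hr₀ hR hgood, coeff_psiQ, eq_single d, Finsupp.single_eq_same, hm, h2, mul_assoc,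
      if_pos (Nat.mul_mod_right _ _), Nat.mul_div_cancel_left _ hqpos, ReducedRun.coeff_unitPart, if_pos (dvd_mul_right _ _), add_comm]
  · rw [coeff_uStar_eq_zero_of_not_dvd X h0 ⟨0, hd⟩, coeff_psiQ]
    split_ifs with h0q
    · rw [ReducedRun.coeff_unitPart, if_neg]
      intro hP
      apply hd
      have hdq := eq_add_mul_div_of_mod_eq (q := 2 ^ e) h0q
      rw [zero_add] at hdq
      obtain ⟨c, hc⟩ := hP
      rw [hdq, hc, h2, ← mul_assoc]
      exact dvd_mul_right _ _
    · rfl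

/-- A legal inverse of `u_*` is `Ψ_q((unitPart …)⁻¹)`. [folklore] -/
theorem inv_of_level (X : StandardExpression 2 (xs K 1) e ℓ F) (hF : F = phiQ (2 ^ e) (two_pow_ne_zero' e) r₀ G + R)
    (hr₀ : r₀ < 2 ^ e) (hR : ResIn (2 ^ e) good R) (hgood : ∀ ρ, good ρ → PairLT ρ r₀) (he : 0 < e) (hle : e ≤ ℓ)
    (h0 : 0 < frontierLength X.support X.u) {k : ℕ} (hk : PowerSeries.order G = k) (hsole : SoleBottom 2 e ℓ X.support X.u)
    {w : MvPowerSeries (Fin 1) K} (hw : w * uStar X.support X.u = 1) :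
    w = psiQ (2 ^ e) (two_pow_ne_zero' e) (ReducedRun.unitPart (2 ^ (ℓ - e)) k G)⁻¹ := by
  set u := ReducedRun.unitPart (2 ^ (ℓ - e)) k G with hu
  have hu0 : PowerSeries.constantCoeff u ≠ 0 := by
    rw [hu, ReducedRun.constantCoeff_unitPart]; exact (PowerSeries.order_eq_nat.mp hk).1
  have hinv : psiQ (2 ^ e) (two_pow_ne_zero' e) u * psiQ (2 ^ e) (two_pow_ne_zero' e) u⁻¹ = 1 := by
    rw [← map_mul, PowerSeries.mul_inv_cancel u hu0, map_one]
  rw [uStar_of_level X hF hr₀ hR hgood he hle h0 hk hsole] at hw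
  calc w = w * (psiQ _ _ u * psiQ _ _ u⁻¹) := by rw [hinv, mul_one]
    _ = psiQ _ _ u⁻¹ := by rw [← mul_assoc, hw, one_mul]

end Datum

end ReducedBridge

end CampaignW24

end Summit.ResolutionOfSingularities.ResolutionOfSingularities.Theorems

end
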